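import Literature.Geometry.Lorentzian.DalembertianNaturality
import HarnessLib

/-!
# Naturality of the Einstein tensor and of Killing fields under local diffeomorphisms

Companion of `ConnectionNaturality.lean` / `CurvatureNaturality.lean` /
`DalembertianNaturality.lean` (same setting: a smooth equidimensional immersion `Φ : N → M`, a
smooth metric `g` on `M`, its pullback `Φ^* g = g.comap …`). These are the transport lemmas one
needs to move a solution of the Einstein equations (with or without matter) and its Killing
symmetries from one chart to another — e.g. from the Weyl–Papapetrou / Boyer–Lindquist coordinates
in which stationary axisymmetric solutions are constructed (Chodosh–Shlapentokh-Rothman, CMP 356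
(2017), §2.1, §3.1) to the ingoing Kerr–Schild exterior of the prelude (`Kerr.exterior`), which is
how the barrier fact `Literature.Barriers.FinalStateConjecture.HairyKerrBifurcation` is carried.
We prove

* `einsteinTensor_comap_apply` — **naturality of the Einstein tensor**:
  `G^{Φ^*g}_u (Y₀, Z₀) = G^g_{Φ u} (dΦ_u Y₀, dΦ_u Z₀)` (from `ricci_comap_apply` and
  `scalarCurvature_comap`); in particular `Φ^*g` is Ricci-flat / vacuum where `g` is
  (`einsteinTensor_comap_eq_zero`);
* `IsKillingField.comap_mpullback` — **Killing fields pull back to Killing fields**: if `X` is a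
  Killing field of `g` then `Φ^*X = (dΦ)⁻¹ (X ∘ Φ)` is a Killing field of `Φ^*g`
  (`leviCivita_comap_mpullback_apply`: `∇^{Φ^*g}_v Φ^*X = (dΦ)⁻¹ ∇^g_{dΦ v} X`).

(The musical isomorphisms and the inverse metric are already natural in the library:
`sharp_comap_apply` in `InitialDataPullback.lean`, `sharp_comap_mfderiv_apply` and
`innerDual_comap_apply` / `innerDual_mvfderiv_comp` in `EndChartIntegral.lean`.)

Everything is proved; no named facts are introduced (D-0026).

## References

* B. O'Neill, *Semi-Riemannian geometry* (1983), Ch. 3, p. 60 (metrically equivalent vectors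
  and one-forms), Prop. 3.59 and Cor. 3.60–3.61, pp. 90–91 (isometries preserve the Levi-Civita
  connection and every curvature quantity); Ch. 9, Def. 9.22–Prop. 9.25, p. 250 (Killing fields;
  `dΦ` carries Killing fields of isometric manifolds to Killing fields); Ch. 12, p. 336 (the
  Einstein tensor).
* R. M. Wald, *General Relativity* (1984), (3.2.28) and Appendix C.1–C.3 (diffeomorphism
  invariance of the Einstein equations; `φ^*` of a Killing field).
-/

noncomputable section

open Bundle Set Function Filter FiberBundle VectorField ContinuousLinearMap
open scoped Manifold ContDiff Topology

namespace Literature.Geometry.Lorentzian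

namespace PseudoRiemannianMetric

variable {E : Type*} [NormedAddCommGroup E] [NormedSpace ℝ E] {H : Type*} [TopologicalSpace H]
  {I : ModelWithCorners ℝ E H} {M : Type*} [TopologicalSpace M] [ChartedSpace H M]
  [IsManifold I ∞ M]
  {E' : Type*} [NormedAddCommGroup E'] [NormedSpace ℝ E'] {H' : Type*} [TopologicalSpace H']
  {I' : ModelWithCorners ℝ E' H'} {N : Type*} [TopologicalSpace N] [ChartedSpace H' N]
  [IsManifold I' ∞ N]
  [FiniteDimensional ℝ E] [FiniteDimensional ℝ E'] [CompleteSpace E] [CompleteSpace E']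
  (g : PseudoRiemannianMetric I ∞ E (TangentSpace I : M → Type _))
  {Φ : N → M} (hpb : contMDiff_pullbackBilin I M I' N ∞) (hΦ : ContMDiff I' I (∞ + 1) Φ)
  (hΦ' : ∀ u, Function.Injective (mfderiv I' I Φ u))
  (hdim : Module.finrank ℝ E' = Module.finrank ℝ E)

/-! ### The Einstein tensor -/

include hΦ' in
/-- **Naturality of the Einstein tensor under local diffeomorphisms**:
`G^{Φ^*g}_u (Y₀, Z₀) = G^g_{Φ u} (dΦ_u Y₀, dΦ_u Z₀)`, from `G = Ric − (S/2) g` and the naturality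
of the Ricci tensor (`ricci_comap_apply`), of the scalar curvature (`scalarCurvature_comap`) and
of the metric itself (`val_comap`). O'Neill 1983, Ch. 3, Prop. 3.59 and Ch. 12, p. 336; Wald 1984,
(3.2.28) and Appendix C.1 (diffeomorphism invariance of Einstein's equation).
[cite: ONeill1983, Ch. 3, Prop. 3.59 and Ch. 12, p. 336] -/
theorem einsteinTensor_comap_apply [g.HasLeviCivita] [(g.comap hpb Φ hΦ hΦ' hdim).HasLeviCivita]
    (u : N) (Y₀ Z₀ : TangentSpace I' u) :
    (g.comap hpb Φ hΦ hΦ' hdim).einsteinTensor u Y₀ Z₀ =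
      g.einsteinTensor (Φ u) (mfderiv I' I Φ u Y₀) (mfderiv I' I Φ u Z₀) := by
  rw [einsteinTensor_apply, einsteinTensor_apply, g.ricci_comap_apply hpb hΦ hΦ' hdim u Y₀ Z₀,
    g.scalarCurvature_comap hpb hΦ hΦ' hdim u, val_comap, pullbackBilin_apply]

include hΦ' in
/-- **The Einstein tensor of `Φ^*g` at `u`, as a bilinear form, is the pullback of that of `g`
at `Φ u`** (bundled form of `einsteinTensor_comap_apply`).
[cite: ONeill1983, Ch. 3, Prop. 3.59 and Ch. 12, p. 336] -/
theorem einsteinTensor_comap [g.HasLeviCivita] [(g.comap hpb Φ hΦ hΦ' hdim).HasLeviCivita]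
    (u : N) :
    (g.comap hpb Φ hΦ hΦ' hdim).einsteinTensor u =
      (g.einsteinTensor (Φ u)).comp (mfderiv I' I Φ u).toLinearMap
        (mfderiv I' I Φ u).toLinearMap := by
  refine LinearMap.ext fun Y₀ ↦ LinearMap.ext fun Z₀ ↦ ?_
  rw [g.einsteinTensor_comap_apply hpb hΦ hΦ' hdim u Y₀ Z₀, LinearMap.BilinForm.comp_apply]
  rfl

include hΦ' in
/-- **Vacuum is preserved by local isometries**: if the Einstein tensor of `g` vanishes at `Φ u`
then that of `Φ^*g` vanishes at `u` (e.g. the pullback of a Ricci-flat metric along an open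
embedding or a change of coordinates solves the vacuum Einstein equations). O'Neill 1983, Ch. 3,
Prop. 3.59 and Ch. 12, p. 336; Wald 1984, Appendix C.1.
[cite: ONeill1983, Ch. 3, Prop. 3.59 and Ch. 12, p. 336] -/
theorem einsteinTensor_comap_eq_zero [g.HasLeviCivita]
    [(g.comap hpb Φ hΦ hΦ' hdim).HasLeviCivita] {u : N} (h : g.einsteinTensor (Φ u) = 0) :
    (g.comap hpb Φ hΦ hΦ' hdim).einsteinTensor u = 0 := by
  rw [g.einsteinTensor_comap hpb hΦ hΦ' hdim u, h]
  rfl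

include hΦ' in
/-- **The Einstein equation with sources is natural**: if `G^g = T` at `Φ u` for a bilinear form
`T` on `T_{Φ u} M`, then `G^{Φ^*g} = Φ^*T` at `u`, where `(Φ^*T)(Y₀, Z₀) = T(dΦ Y₀, dΦ Z₀)`.
Wald 1984, Appendix C.1 (general covariance: `(φ^*g, φ^*T)` solves Einstein's equation whenever
`(g, T)` does). [cite: ONeill1983, Ch. 3, Prop. 3.59 and Ch. 12, p. 336] -/
theorem einsteinTensor_comap_eq_comp [g.HasLeviCivita]
    [(g.comap hpb Φ hΦ hΦ' hdim).HasLeviCivita] {u : N}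
    {T : LinearMap.BilinForm ℝ (TangentSpace I (Φ u))} (h : g.einsteinTensor (Φ u) = T) :
    (g.comap hpb Φ hΦ hΦ' hdim).einsteinTensor u =
      T.comp (mfderiv I' I Φ u).toLinearMap (mfderiv I' I Φ u).toLinearMap := by
  rw [g.einsteinTensor_comap hpb hΦ hΦ' hdim u, h]

/-! ### Killing fields -/

omit [CompleteSpace E] [CompleteSpace E'] in
include hΦ' in
/-- **The Killing equation is natural.** For a vector field `X` on `M` differentiable at `Φ u`,
the `Φ^*g`-deformation of `Φ^*X` at `u` is the `g`-deformation of `X` at `Φ u` read through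
`dΦ_u`: `(Φ^*g)(∇^{Φ^*g}_{Y₀} Φ^*X, Z₀) + (Φ^*g)(Y₀, ∇^{Φ^*g}_{Z₀} Φ^*X)
 = g(∇^g_{dΦ Y₀} X, dΦ Z₀) + g(dΦ Y₀, ∇^g_{dΦ Z₀} X)` (`leviCivita_comap_mpullback_apply`).
O'Neill 1983, Ch. 3, Prop. 3.59 with Ch. 9, Prop. 9.25. [cite: ONeill1983, Ch. 9, Prop. 9.25] -/
theorem val_leviCivita_mpullback_add [g.HasLeviCivita]
    [(g.comap hpb Φ hΦ hΦ' hdim).HasLeviCivita] {u : N} {X : Π x : M, TangentSpace I x}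
    (hX : MDiffAt (T% X) (Φ u)) (Y₀ Z₀ : TangentSpace I' u) :
    (g.comap hpb Φ hΦ hΦ' hdim).val u
          ((g.comap hpb Φ hΦ hΦ' hdim).leviCivita (mpullback I' I Φ X) u Y₀) Z₀ +
        (g.comap hpb Φ hΦ hΦ' hdim).val u Y₀
          ((g.comap hpb Φ hΦ hΦ' hdim).leviCivita (mpullback I' I Φ X) u Z₀) =
      g.val (Φ u) (g.leviCivita X (Φ u) (mfderiv I' I Φ u Y₀)) (mfderiv I' I Φ u Z₀) +
        g.val (Φ u) (mfderiv I' I Φ u Y₀) (g.leviCivita X (Φ u) (mfderiv I' I Φ u Z₀)) := by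
  have hinv := isInvertible_mfderiv_of_injective (Φ := Φ) hdim (hΦ' u)
  rw [g.leviCivita_comap_mpullback_apply hpb hΦ hΦ' hdim hX Y₀,
    g.leviCivita_comap_mpullback_apply hpb hΦ hΦ' hdim hX Z₀, val_comap, pullbackBilin_apply,
    pullbackBilin_apply, hinv.self_apply_inverse, hinv.self_apply_inverse]

omit [CompleteSpace E] in
include hΦ' in
/-- **Killing fields pull back to Killing fields under local isometries.** If `X` is a Killing
field of `g` (smooth, `g(∇_Y X, Z) + g(Y, ∇_Z X) = 0`), then `Φ^*X = (dΦ)⁻¹ (X ∘ Φ)` is a Killing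
field of `Φ^*g`: it is smooth (`ContMDiff.mpullback_vectorField`, `Φ` being `C^∞` with invertible
differentials) and satisfies the Killing equation by `val_leviCivita_mpullback_add`. This is the
statement that a (local) isometry `Φ : (N, Φ^*g) → (M, g)` carries the Killing field `X` of `g`
to the `Φ`-related Killing field of `Φ^*g` — e.g. the stationary and axial Killing fields
`∂_t, ∂_φ` of a stationary axisymmetric spacetime, read in another chart. O'Neill 1983, Ch. 9,
Def. 9.22–Prop. 9.25 (p. 250) with Ch. 3, Prop. 3.59; Wald 1984, Appendix C.3.
[cite: ONeill1983, Ch. 9, Prop. 9.25] -/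
theorem IsKillingField.comap_mpullback [g.HasLeviCivita]
    [(g.comap hpb Φ hΦ hΦ' hdim).HasLeviCivita] {X : Π x : M, TangentSpace I x}
    (hX : g.IsKillingField X) :
    (g.comap hpb Φ hΦ hΦ' hdim).IsKillingField (mpullback I' I Φ X) := by
  have hinv : ∀ u, (mfderiv I' I Φ u).IsInvertible := fun u ↦
    isInvertible_mfderiv_of_injective (Φ := Φ) hdim (hΦ' u)
  refine ⟨hX.contMDiff.mpullback_vectorField hΦ hinv le_rfl, fun u Y₀ Z₀ ↦ ?_⟩
  have hXd : MDiffAt (T% X) (Φ u) :=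
    (hX.contMDiff (Φ u)).mdifferentiableAt (by simp)
  rw [g.val_leviCivita_mpullback_add hpb hΦ hΦ' hdim hXd Y₀ Z₀]
  exact hX.val_leviCivita_add (Φ u) _ _

end PseudoRiemannianMetric

end Literature.Geometry.Lorentzian

end
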